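import Summits.HodgeConjecture.HodgeConjecture.Theorems.HodgeLocusCensusPlaneSumRank8
import Summits.HodgeConjecture.HodgeConjecture.Theorems.HodgeLocusCensusPlaneSumCertsA
import Summits.HodgeConjecture.HodgeConjecture.Theorems.HodgeLocusCensusPlaneSumCertsB
import Summits.HodgeConjecture.HodgeConjecture.Theorems.HodgeLocusCensusPlaneSumCertsC
import HarnessLib

/-!
# HodgeLocusCensusPlaneSumCells8 — PROVED: the six plane-sum census rows of the Fermat quartic EIGHTFOLD (ranks 89, 95, 83, 83, 119, 119) (cell pub-hlocus, LEAD gen 5, (T36))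
HONEST FRAMING: certified instances and evidence bearing on the general Hodge conjecture; no claim.

Corollaries of `ivhsRankEq_of_cert8` (`HodgeLocusCensusPlaneSumRank8`) and the kernel-checked certificates (`HodgeLocusCensusPlaneSumCertsA/B/C`):
the typed rows `explainedSmooth_8_4_scroll` ([Z] − [Π], rank 89), `firstOrder_8_4_zPlusPi` ([Z] + [Π], 95), the twist cells [Z] ∓ [Z′] (83, 83) of
`HodgeLocusCensusTwistCells` and `explainedSmooth_8_4_ZplusPiPrime` / `notAlpha_8_4_ZminusPiPrime` ([Z] ± [Π′], 119, 119) of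
`HodgeLocusCensusGrassmannianCells` HOLD: rank [p_{i+j}(δ)] = r over every field of characteristic 0 and every primitive 8th root of unity.
What is proved is exactly the typed first-order statement (the rank of Movasati's matrix); the census LABELS of these rows (EXPLAINED-SMOOTH /
NOT (α) / OPEN INSTANCE: the geometry of the Hodge locus beyond first order) are records of the cell, not Lean theorems, and are untouched.
-/

namespace Summit.HodgeConjecture.HodgeConjecture.HodgeLocus.Census.PlaneSum

open TwistCells GrSection

/-- the census class `scrollMinus8` on X⁴_8 is the plane list of `scrollL`. -/
theorem scroll_list8 : scrollMinus8 = planeList8 scrollL := by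
  simp [scrollMinus8, planeList8, scrollL]

/-- PROVED ROW: `TwistCells.explainedSmooth_8_4_scroll` — rank [p_{i+j}(δ)] = 89. -/
theorem explainedSmooth_8_4_scroll_holds : TwistCells.explainedSmooth_8_4_scroll := by
  unfold TwistCells.explainedSmooth_8_4_scroll ExplainedSmoothRow
  rw [scroll_list8]
  exact ivhsRankEq_of_cert8 scrollL scrollCert scroll_valid scrollModeK8 scrollOff8 scroll_H1_8 scroll_H2_8 scroll_H3_8

/-- the census class `zPlusPi8` on X⁴_8 is the plane list of `zPlusPiL`. -/
theorem zPlusPi_list8 : zPlusPi8 = planeList8 zPlusPiL := by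
  simp [zPlusPi8, planeList8, zPlusPiL]

/-- PROVED ROW: `TwistCells.firstOrder_8_4_zPlusPi` — rank [p_{i+j}(δ)] = 95. -/
theorem firstOrder_8_4_zPlusPi_holds : TwistCells.firstOrder_8_4_zPlusPi := by
  unfold TwistCells.firstOrder_8_4_zPlusPi
  rw [zPlusPi_list8]
  exact ivhsRankEq_of_cert8 zPlusPiL zPlusPiCert zPlusPi_valid zPlusPiModeK8 zPlusPiOff8 zPlusPi_H1_8 zPlusPi_H2_8 zPlusPi_H3_8

/-- the census class `twistMinus8` on X⁴_8 is the plane list of `twistMinusL`. -/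
theorem twistMinus_list8 : twistMinus8 = planeList8 twistMinusL := by
  simp [twistMinus8, planeList8, twistMinusL]

/-- PROVED ROW: `TwistCells.firstOrder_8_4_twistMinus` — rank [p_{i+j}(δ)] = 83. -/
theorem firstOrder_8_4_twistMinus_holds : TwistCells.firstOrder_8_4_twistMinus := by
  unfold TwistCells.firstOrder_8_4_twistMinus
  rw [twistMinus_list8]
  exact ivhsRankEq_of_cert8 twistMinusL twistMinusCert twistMinus_valid twistMinusModeK8 twistMinusOff8 twistMinus_H1_8 twistMinus_H2_8 twistMinus_H3_8

/-- the census class `twistPlus8` on X⁴_8 is the plane list of `twistPlusL`. -/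
theorem twistPlus_list8 : twistPlus8 = planeList8 twistPlusL := by
  simp [twistPlus8, planeList8, twistPlusL]

/-- PROVED ROW: `TwistCells.firstOrder_8_4_twistPlus` — rank [p_{i+j}(δ)] = 83. -/
theorem firstOrder_8_4_twistPlus_holds : TwistCells.firstOrder_8_4_twistPlus := by
  unfold TwistCells.firstOrder_8_4_twistPlus
  rw [twistPlus_list8]
  exact ivhsRankEq_of_cert8 twistPlusL twistPlusCert twistPlus_valid twistPlusModeK8 twistPlusOff8 twistPlus_H1_8 twistPlus_H2_8 twistPlus_H3_8

/-- the census class `explainedSmooth_8_4_ZplusPiPrime` on X⁴_8 is the plane list of `zPlusPiPrimeL`. -/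
theorem zPlusPiPrime_list8 : [(1, plane84 0 0 0 0 0), (1, plane84 0 2 0 0 0), (1, plane84 3 0 0 0 0), (1, plane84 3 2 0 0 0), (1, plane84 0 0 1 0 0)] = planeList8 zPlusPiPrimeL := by
  simp [planeList8, zPlusPiPrimeL]

/-- PROVED ROW: `GrSection.explainedSmooth_8_4_ZplusPiPrime` — rank [p_{i+j}(δ)] = 119. -/
theorem explainedSmooth_8_4_ZplusPiPrime_holds : GrSection.explainedSmooth_8_4_ZplusPiPrime := by
  unfold GrSection.explainedSmooth_8_4_ZplusPiPrime ExplainedSmoothRow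
  rw [zPlusPiPrime_list8]
  exact ivhsRankEq_of_cert8 zPlusPiPrimeL zPlusPiPrimeCert zPlusPiPrime_valid zPlusPiPrimeModeK8 zPlusPiPrimeOff8 zPlusPiPrime_H1_8 zPlusPiPrime_H2_8 zPlusPiPrime_H3_8

/-- the census class `notAlpha_8_4_ZminusPiPrime` on X⁴_8 is the plane list of `zMinusPiPrimeL`. -/
theorem zMinusPiPrime_list8 : [(1, plane84 0 0 0 0 0), (1, plane84 0 2 0 0 0), (1, plane84 3 0 0 0 0), (1, plane84 3 2 0 0 0), (-1, plane84 0 0 1 0 0)] = planeList8 zMinusPiPrimeL := by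
  simp [planeList8, zMinusPiPrimeL]

/-- PROVED ROW: `GrSection.notAlpha_8_4_ZminusPiPrime` — rank [p_{i+j}(δ)] = 119. -/
theorem notAlpha_8_4_ZminusPiPrime_holds : GrSection.notAlpha_8_4_ZminusPiPrime := by
  unfold GrSection.notAlpha_8_4_ZminusPiPrime
  rw [zMinusPiPrime_list8]
  exact ivhsRankEq_of_cert8 zMinusPiPrimeL zMinusPiPrimeCert zMinusPiPrime_valid zMinusPiPrimeModeK8 zMinusPiPrimeOff8 zMinusPiPrime_H1_8 zMinusPiPrime_H2_8 zMinusPiPrime_H3_8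

end Summit.HodgeConjecture.HodgeConjecture.HodgeLocus.Census.PlaneSum
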